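import Mathlib.Algebra.Group.Pi.Units
import Literature.Computability.AlgebraicComplexity.QuantumFunctionalsDegenerationProofs
import Literature.Computability.AlgebraicComplexity.QuantumFunctionalSpectral
import HarnessLib

/-!
# Quantum functionals: proof of restriction monotonicity (CVZ Cor. 3.31 / Thm. 3.19.4)

Topic: `Literature/Computability/AlgebraicComplexity`. This file discharges the named fact
`ChristandlVranaZuiddam2023_restriction_mono` of `QuantumFunctionals.lean`
(Christandl–Vrana–Zuiddam, *Universal points in the asymptotic spectrum of tensors*,
J. Amer. Math. Soc. 36 (2023), arXiv:1709.07851v3): for `θ ∈ P([3])`, a complex 3-tensor `s`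
and matrices `A, B, C` of *arbitrary formats*, `F^θ((A ⊗ B ⊗ C)·s) ≤ F^θ(s)`, where
`F^θ = 2^{E_θ}` and `E_θ(t) = sup_{g ∈ GL × GL × GL} H_θ(g·t)` is the (lower) logarithmic
quantum functional `logQuantumFunctional` (CVZ Def. 3.16).

## The printed proof and what is done here

In the source, `≥`-monotonicity of `F_θ` is Thm. 3.19.4 = Lemma 3.20 (monotone under
degeneration `⊵`, by continuity of `H_θ` along `g_i·s → t`, p. 15) together with Rem. 1.2
(restriction implies degeneration) and Rem. 3.17 (`E_θ` "is not sensitive to embedding each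
`V_j` in some larger vector space", which reduces restrictions between different formats to one
format). Lemma 3.20 for one format is the sibling `QuantumFunctionalsDegenerationProofs.lean`
(`quantumEntropy_le_logQuantumFunctional_of_degeneratesTo`); this file supplies the two remaining
steps in coordinates:

* **Rem. 3.17, format-free** (`quantumEntropy_actTensor_eq_of_gram_eq`,
  `tensorNormSq_actTensor_eq_of_gram_eq`): `H_θ((N₁ ⊗ N₂ ⊗ N₃)·s)` and `‖(N₁ ⊗ N₂ ⊗ N₃)·s‖²`
  depend on rectangular `N_j` (any target formats) only through the Gram matrices `N_jᴴ N_j`.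
  Indeed `|t⟩⟨t|₁ = N₁ W N₁ᴴ` for `t = (N₁ ⊗ N₂ ⊗ N₃)·s`, with `W = T₁ (N₂ᴴN₂ ⊗ₖ N₃ᴴN₃)ᵀ T₁ᴴ`
  (`T₁ = flatten₁ s`; `reducedDensity₁_actTensor`), and by `Matrix.charpoly_mul_comm'` the
  characteristic polynomial of `N₁ W N₁ᴴ` is that of `W N₁ᴴN₁` up to a power of `X`
  (`charpoly_conj_eq_of_gram_eq`); the entropy is a spectral sum of `-x log x`, blind to zero
  eigenvalues (`sum_eigenvalues_eq_of_X_pow_mul_charpoly_eq` of `QuantumFunctionalSpectral.lean`).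
* **Rem. 1.2 in the form needed** (`tensorDegeneratesTo_actTensor_of_path`,
  `exists_gram_sqrt_path`): every positive semidefinite `P` is `RᴴR` with `R = diag(√λ) Uᴴ`
  square, and `R + ε Uᴴ ∈ GL` for `ε > 0` tends to `R` as `ε → 0⁺`, so `s ⊵ (R₁ ⊗ R₂ ⊗ R₃)·s`.

Given rectangular `M_j` with `(M₁ ⊗ M₂ ⊗ M₃)·s ≠ 0`, choosing `R_j` with `R_jᴴR_j = M_jᴴM_j` gives
`H_θ((M₁ ⊗ M₂ ⊗ M₃)·s) = H_θ((R₁ ⊗ R₂ ⊗ R₃)·s) ≤ E_θ(s)`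
(`quantumEntropy_actTensor_le_logQuantumFunctional_of_ne_zero`); the supremum over
`g ∈ GL × GL × GL` acting on `(A ⊗ B ⊗ C)·s` gives `E_θ((A ⊗ B ⊗ C)·s) ≤ E_θ(s)`
(`logQuantumFunctional_actTensor_le`), and exponentiating,
`ChristandlVranaZuiddam2023_restriction_mono_holds`.

No new definitions; nothing here restates the fact.
-/

noncomputable section

open scoped BigOperators Matrix ComplexOrder Kronecker Polynomial
open _root_.Topology Filter
open Polynomial (X)
open Real (negMulLog)

namespace Literature.Computability.AlgebraicComplexity

universe u

/-! ## The quantum marginals of `(A ⊗ B ⊗ C)·t` through flattenings -/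

section ActAlgebra

variable {ι κ μ ι' κ' μ' : Type*} [Fintype ι] [Fintype κ] [Fintype μ]

/-- `flatten₁ ((A ⊗ B ⊗ C)·t) = A · flatten₁ t · (B ⊗ₖ C)ᵀ`. [folklore] -/
theorem flatten₁_actTensor (A : Matrix ι' ι ℂ) (B : Matrix κ' κ ℂ) (C : Matrix μ' μ ℂ)
    (t : ι → κ → μ → ℂ) : flatten₁ (actTensor A B C t) = A * flatten₁ t * (B ⊗ₖ C)ᵀ := by
  ext a ⟨b, c⟩
  simp only [flatten₁, Matrix.of_apply, actTensor_apply, Matrix.mul_apply, Matrix.transpose_apply,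
    Matrix.kroneckerMap_apply, Fintype.sum_prod_type, Finset.sum_mul]
  rw [Finset.sum_comm]
  refine Finset.sum_congr rfl fun b' _ => ?_
  rw [Finset.sum_comm]
  refine Finset.sum_congr rfl fun c' _ => Finset.sum_congr rfl fun a' _ => ?_
  ring

/-- `flatten₂ ((A ⊗ B ⊗ C)·t) = B · flatten₂ t · (A ⊗ₖ C)ᵀ`. [folklore] -/
theorem flatten₂_actTensor (A : Matrix ι' ι ℂ) (B : Matrix κ' κ ℂ) (C : Matrix μ' μ ℂ)
    (t : ι → κ → μ → ℂ) : flatten₂ (actTensor A B C t) = B * flatten₂ t * (A ⊗ₖ C)ᵀ := by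
  ext b ⟨a, c⟩
  simp only [flatten₂, Matrix.of_apply, actTensor_apply, Matrix.mul_apply, Matrix.transpose_apply,
    Matrix.kroneckerMap_apply, Fintype.sum_prod_type, Finset.sum_mul]
  refine Finset.sum_congr rfl fun a' _ => ?_
  rw [Finset.sum_comm]
  refine Finset.sum_congr rfl fun c' _ => Finset.sum_congr rfl fun b' _ => ?_
  ring

/-- `flatten₃ ((A ⊗ B ⊗ C)·t) = C · flatten₃ t · (A ⊗ₖ B)ᵀ`. [folklore] -/
theorem flatten₃_actTensor (A : Matrix ι' ι ℂ) (B : Matrix κ' κ ℂ) (C : Matrix μ' μ ℂ)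
    (t : ι → κ → μ → ℂ) : flatten₃ (actTensor A B C t) = C * flatten₃ t * (A ⊗ₖ B)ᵀ := by
  ext c ⟨a, b⟩
  simp only [flatten₃, Matrix.of_apply, actTensor_apply, Matrix.mul_apply, Matrix.transpose_apply,
    Matrix.kroneckerMap_apply, Fintype.sum_prod_type, Finset.sum_mul]
  refine Finset.sum_congr rfl fun a' _ => Finset.sum_congr rfl fun b' _ =>
    Finset.sum_congr rfl fun c' _ => ?_
  ring

variable [Fintype ι'] [Fintype κ'] [Fintype μ']

omit [Fintype ι'] in
/-- The first quantum marginal of `(A ⊗ B ⊗ C)·t` is `A W Aᴴ` with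
`W = T₁ ((BᴴB) ⊗ₖ (CᴴC))ᵀ T₁ᴴ`, `T₁ = flatten₁ t`. [folklore] -/
theorem reducedDensity₁_actTensor (A : Matrix ι' ι ℂ) (B : Matrix κ' κ ℂ) (C : Matrix μ' μ ℂ)
    (t : ι → κ → μ → ℂ) :
    reducedDensity₁ (actTensor A B C t) =
      A * (flatten₁ t * ((Bᴴ * B) ⊗ₖ (Cᴴ * C))ᵀ * (flatten₁ t)ᴴ) * Aᴴ := by
  have hK : ((Bᴴ * B) ⊗ₖ (Cᴴ * C))ᵀ = (B ⊗ₖ C)ᵀ * ((B ⊗ₖ C)ᵀ)ᴴ := by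
    rw [Matrix.mul_kronecker_mul, ← Matrix.conjTranspose_kronecker, Matrix.transpose_mul]
    congr 1
  rw [reducedDensity₁, flatten₁_actTensor, hK, Matrix.conjTranspose_mul, Matrix.conjTranspose_mul]
  simp only [Matrix.mul_assoc]

omit [Fintype κ'] in
/-- The second quantum marginal of `(A ⊗ B ⊗ C)·t` is `B W Bᴴ` with
`W = T₂ ((AᴴA) ⊗ₖ (CᴴC))ᵀ T₂ᴴ`, `T₂ = flatten₂ t`. [folklore] -/
theorem reducedDensity₂_actTensor (A : Matrix ι' ι ℂ) (B : Matrix κ' κ ℂ) (C : Matrix μ' μ ℂ)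
    (t : ι → κ → μ → ℂ) :
    reducedDensity₂ (actTensor A B C t) =
      B * (flatten₂ t * ((Aᴴ * A) ⊗ₖ (Cᴴ * C))ᵀ * (flatten₂ t)ᴴ) * Bᴴ := by
  have hK : ((Aᴴ * A) ⊗ₖ (Cᴴ * C))ᵀ = (A ⊗ₖ C)ᵀ * ((A ⊗ₖ C)ᵀ)ᴴ := by
    rw [Matrix.mul_kronecker_mul, ← Matrix.conjTranspose_kronecker, Matrix.transpose_mul]
    congr 1
  rw [reducedDensity₂, flatten₂_actTensor, hK, Matrix.conjTranspose_mul, Matrix.conjTranspose_mul]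
  simp only [Matrix.mul_assoc]

omit [Fintype μ'] in
/-- The third quantum marginal of `(A ⊗ B ⊗ C)·t` is `C W Cᴴ` with
`W = T₃ ((AᴴA) ⊗ₖ (BᴴB))ᵀ T₃ᴴ`, `T₃ = flatten₃ t`. [folklore] -/
theorem reducedDensity₃_actTensor (A : Matrix ι' ι ℂ) (B : Matrix κ' κ ℂ) (C : Matrix μ' μ ℂ)
    (t : ι → κ → μ → ℂ) :
    reducedDensity₃ (actTensor A B C t) =
      C * (flatten₃ t * ((Aᴴ * A) ⊗ₖ (Bᴴ * B))ᵀ * (flatten₃ t)ᴴ) * Cᴴ := by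
  have hK : ((Aᴴ * A) ⊗ₖ (Bᴴ * B))ᵀ = (A ⊗ₖ B)ᵀ * ((A ⊗ₖ B)ᵀ)ᴴ := by
    rw [Matrix.mul_kronecker_mul, ← Matrix.conjTranspose_kronecker, Matrix.transpose_mul]
    congr 1
  rw [reducedDensity₃, flatten₃_actTensor, hK, Matrix.conjTranspose_mul, Matrix.conjTranspose_mul]
  simp only [Matrix.mul_assoc]

end ActAlgebra

/-! ## Gram invariance of `H_θ((N₁ ⊗ N₂ ⊗ N₃)·s)` (CVZ Rem. 3.17 in coordinates) -/

section Gram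

/-- `X^{|m'|+|n|} χ(N W Nᴴ) = X^{|m|+|n|} χ(N' W N'ᴴ)` whenever `NᴴN = N'ᴴN'`
(`Matrix.charpoly_mul_comm'` twice: both sides are `X`-powers times `χ(W NᴴN)`). [folklore] -/
theorem charpoly_conj_eq_of_gram_eq {m m' n : Type*} [Fintype m] [Fintype m'] [Fintype n]
    [DecidableEq m] [DecidableEq m'] [DecidableEq n] (N : Matrix m n ℂ) (N' : Matrix m' n ℂ)
    (W : Matrix n n ℂ) (h : Nᴴ * N = N'ᴴ * N') :
    X ^ (Fintype.card m' + Fintype.card n) * (N * W * Nᴴ).charpoly =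
      X ^ (Fintype.card m + Fintype.card n) * (N' * W * N'ᴴ).charpoly := by
  have h1 : X ^ Fintype.card n * (N * W * Nᴴ).charpoly =
      X ^ Fintype.card m * (W * (Nᴴ * N)).charpoly := by
    rw [Matrix.mul_assoc, Matrix.charpoly_mul_comm', Matrix.mul_assoc]
  have h2 : X ^ Fintype.card n * (N' * W * N'ᴴ).charpoly =
      X ^ Fintype.card m' * (W * (N'ᴴ * N')).charpoly := by
    rw [Matrix.mul_assoc, Matrix.charpoly_mul_comm', Matrix.mul_assoc]
  rw [pow_add, pow_add, mul_assoc, mul_assoc, h1, h2, h, mul_left_comm]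

variable {ι κ μ ι' κ' μ' ι'' κ'' μ'' : Type*} [Fintype ι] [Fintype κ] [Fintype μ]
  [Fintype ι'] [Fintype κ'] [Fintype μ'] [Fintype ι''] [Fintype κ''] [Fintype μ'']

/-- `⟨t|t⟩ = Re Tr |t⟩⟨t|₁`. [folklore] -/
theorem tensorNormSq_eq_re_trace (t : ι → κ → μ → ℂ) :
    tensorNormSq t = RCLike.re (reducedDensity₁ t).trace := by
  rw [trace_reducedDensity₁]
  simp

/-- `‖(N₁ ⊗ N₂ ⊗ N₃)·s‖²` depends on the `N_j` only through the Gram matrices `N_jᴴ N_j`.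
[cite: ChristandlVranaZuiddam2023, Rem. 3.17] -/
theorem tensorNormSq_actTensor_eq_of_gram_eq (s : ι → κ → μ → ℂ) {N₁ : Matrix ι' ι ℂ}
    {N₁' : Matrix ι'' ι ℂ} {N₂ : Matrix κ' κ ℂ} {N₂' : Matrix κ'' κ ℂ} {N₃ : Matrix μ' μ ℂ}
    {N₃' : Matrix μ'' μ ℂ} (h₁ : N₁ᴴ * N₁ = N₁'ᴴ * N₁') (h₂ : N₂ᴴ * N₂ = N₂'ᴴ * N₂')
    (h₃ : N₃ᴴ * N₃ = N₃'ᴴ * N₃') :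
    tensorNormSq (actTensor N₁ N₂ N₃ s) = tensorNormSq (actTensor N₁' N₂' N₃' s) := by
  rw [tensorNormSq_eq_re_trace, tensorNormSq_eq_re_trace, reducedDensity₁_actTensor,
    reducedDensity₁_actTensor, Matrix.trace_mul_cycle N₁, h₁, h₂, h₃, Matrix.trace_mul_cycle N₁']

variable [DecidableEq ι] [DecidableEq κ] [DecidableEq μ] [DecidableEq ι'] [DecidableEq κ']
  [DecidableEq μ'] [DecidableEq ι''] [DecidableEq κ''] [DecidableEq μ'']

omit [DecidableEq κ] [DecidableEq μ] [DecidableEq κ'] [DecidableEq μ'] [DecidableEq κ'']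
  [DecidableEq μ''] in
/-- Gram invariance of the first marginal entropy `H(r₁((N₁ ⊗ N₂ ⊗ N₃)·s))`.
[cite: ChristandlVranaZuiddam2023, Rem. 3.17] -/
theorem shannonEntropy_marginalSpectrum₁_actTensor_eq_of_gram_eq (s : ι → κ → μ → ℂ)
    {N₁ : Matrix ι' ι ℂ} {N₁' : Matrix ι'' ι ℂ} {N₂ : Matrix κ' κ ℂ} {N₂' : Matrix κ'' κ ℂ}
    {N₃ : Matrix μ' μ ℂ} {N₃' : Matrix μ'' μ ℂ} (h₁ : N₁ᴴ * N₁ = N₁'ᴴ * N₁')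
    (h₂ : N₂ᴴ * N₂ = N₂'ᴴ * N₂') (h₃ : N₃ᴴ * N₃ = N₃'ᴴ * N₃') :
    shannonEntropy (marginalSpectrum₁ (actTensor N₁ N₂ N₃ s)) =
      shannonEntropy (marginalSpectrum₁ (actTensor N₁' N₂' N₃' s)) := by
  simp only [shannonEntropy, marginalSpectrum₁]
  rw [tensorNormSq_actTensor_eq_of_gram_eq s h₁ h₂ h₃]
  congr 1
  refine sum_eigenvalues_eq_of_X_pow_mul_charpoly_eq _ _ (a := Fintype.card ι'' + Fintype.card ι)
    (b := Fintype.card ι' + Fintype.card ι) ?_ (f := fun x => negMulLog (x / _)) (by simp)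
  rw [reducedDensity₁_actTensor, reducedDensity₁_actTensor, h₂, h₃]
  exact charpoly_conj_eq_of_gram_eq N₁ N₁' _ h₁

omit [DecidableEq ι] [DecidableEq μ] [DecidableEq ι'] [DecidableEq μ'] [DecidableEq ι'']
  [DecidableEq μ''] in
/-- Gram invariance of the second marginal entropy `H(r₂((N₁ ⊗ N₂ ⊗ N₃)·s))`.
[cite: ChristandlVranaZuiddam2023, Rem. 3.17] -/
theorem shannonEntropy_marginalSpectrum₂_actTensor_eq_of_gram_eq (s : ι → κ → μ → ℂ)
    {N₁ : Matrix ι' ι ℂ} {N₁' : Matrix ι'' ι ℂ} {N₂ : Matrix κ' κ ℂ} {N₂' : Matrix κ'' κ ℂ}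
    {N₃ : Matrix μ' μ ℂ} {N₃' : Matrix μ'' μ ℂ} (h₁ : N₁ᴴ * N₁ = N₁'ᴴ * N₁')
    (h₂ : N₂ᴴ * N₂ = N₂'ᴴ * N₂') (h₃ : N₃ᴴ * N₃ = N₃'ᴴ * N₃') :
    shannonEntropy (marginalSpectrum₂ (actTensor N₁ N₂ N₃ s)) =
      shannonEntropy (marginalSpectrum₂ (actTensor N₁' N₂' N₃' s)) := by
  simp only [shannonEntropy, marginalSpectrum₂]
  rw [tensorNormSq_actTensor_eq_of_gram_eq s h₁ h₂ h₃]
  congr 1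
  refine sum_eigenvalues_eq_of_X_pow_mul_charpoly_eq _ _ (a := Fintype.card κ'' + Fintype.card κ)
    (b := Fintype.card κ' + Fintype.card κ) ?_ (f := fun x => negMulLog (x / _)) (by simp)
  rw [reducedDensity₂_actTensor, reducedDensity₂_actTensor, h₁, h₃]
  exact charpoly_conj_eq_of_gram_eq N₂ N₂' _ h₂

omit [DecidableEq ι] [DecidableEq κ] [DecidableEq ι'] [DecidableEq κ'] [DecidableEq ι'']
  [DecidableEq κ''] in
/-- Gram invariance of the third marginal entropy `H(r₃((N₁ ⊗ N₂ ⊗ N₃)·s))`.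
[cite: ChristandlVranaZuiddam2023, Rem. 3.17] -/
theorem shannonEntropy_marginalSpectrum₃_actTensor_eq_of_gram_eq (s : ι → κ → μ → ℂ)
    {N₁ : Matrix ι' ι ℂ} {N₁' : Matrix ι'' ι ℂ} {N₂ : Matrix κ' κ ℂ} {N₂' : Matrix κ'' κ ℂ}
    {N₃ : Matrix μ' μ ℂ} {N₃' : Matrix μ'' μ ℂ} (h₁ : N₁ᴴ * N₁ = N₁'ᴴ * N₁')
    (h₂ : N₂ᴴ * N₂ = N₂'ᴴ * N₂') (h₃ : N₃ᴴ * N₃ = N₃'ᴴ * N₃') :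
    shannonEntropy (marginalSpectrum₃ (actTensor N₁ N₂ N₃ s)) =
      shannonEntropy (marginalSpectrum₃ (actTensor N₁' N₂' N₃' s)) := by
  simp only [shannonEntropy, marginalSpectrum₃]
  rw [tensorNormSq_actTensor_eq_of_gram_eq s h₁ h₂ h₃]
  congr 1
  refine sum_eigenvalues_eq_of_X_pow_mul_charpoly_eq _ _ (a := Fintype.card μ'' + Fintype.card μ)
    (b := Fintype.card μ' + Fintype.card μ) ?_ (f := fun x => negMulLog (x / _)) (by simp)
  rw [reducedDensity₃_actTensor, reducedDensity₃_actTensor, h₁, h₂]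
  exact charpoly_conj_eq_of_gram_eq N₃ N₃' _ h₃

/-- **Gram invariance of `H_θ`** (CVZ Rem. 3.17 in coordinates): `H_θ((N₁ ⊗ N₂ ⊗ N₃)·s)` depends
on the rectangular matrices `N_j` (of arbitrary target formats) only through `N_jᴴ N_j`.
[cite: ChristandlVranaZuiddam2023, Rem. 3.17] -/
theorem quantumEntropy_actTensor_eq_of_gram_eq (θ : Fin 3 → ℝ) (s : ι → κ → μ → ℂ)
    {N₁ : Matrix ι' ι ℂ} {N₁' : Matrix ι'' ι ℂ} {N₂ : Matrix κ' κ ℂ} {N₂' : Matrix κ'' κ ℂ}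
    {N₃ : Matrix μ' μ ℂ} {N₃' : Matrix μ'' μ ℂ} (h₁ : N₁ᴴ * N₁ = N₁'ᴴ * N₁')
    (h₂ : N₂ᴴ * N₂ = N₂'ᴴ * N₂') (h₃ : N₃ᴴ * N₃ = N₃'ᴴ * N₃') :
    quantumEntropy θ (actTensor N₁ N₂ N₃ s) = quantumEntropy θ (actTensor N₁' N₂' N₃' s) := by
  simp only [quantumEntropy, shannonEntropy_marginalSpectrum₁_actTensor_eq_of_gram_eq s h₁ h₂ h₃,
    shannonEntropy_marginalSpectrum₂_actTensor_eq_of_gram_eq s h₁ h₂ h₃,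
    shannonEntropy_marginalSpectrum₃_actTensor_eq_of_gram_eq s h₁ h₂ h₃]

end Gram

/-! ## Singular actions as limits of invertible ones, and the main theorem -/

section Main

/-- A positive semidefinite matrix is a Gram matrix `RᴴR` of a *square* `R` admitting invertible
perturbations `R + εV` for all `ε > 0`: `R = diag(√λ) Uᴴ`, `V = Uᴴ` from the spectral theorem
`P = U diag(λ) Uᴴ`, `λ ≥ 0`. [folklore] -/
theorem exists_gram_sqrt_path {n : Type*} [Fintype n] [DecidableEq n] {P : Matrix n n ℂ}
    (hP : P.PosSemidef) :
    ∃ R V : Matrix n n ℂ, Rᴴ * R = P ∧ ∀ ε : ℝ, 0 < ε → IsUnit (R + (ε : ℂ) • V) := by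
  have hdd : (fun i => ((Real.sqrt (hP.1.eigenvalues i) : ℝ) : ℂ) *
      (Real.sqrt (hP.1.eigenvalues i) : ℝ)) = RCLike.ofReal ∘ hP.1.eigenvalues :=
      funext fun i => by
    rw [← Complex.ofReal_mul, Real.mul_self_sqrt (hP.eigenvalues_nonneg i)]
    rfl
  have hdstar : star (fun i => ((Real.sqrt (hP.1.eigenvalues i) : ℝ) : ℂ)) =
      fun i => ((Real.sqrt (hP.1.eigenvalues i) : ℝ) : ℂ) := funext fun i => by simp
  refine ⟨Matrix.diagonal (fun i => ((Real.sqrt (hP.1.eigenvalues i) : ℝ) : ℂ)) *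
      star (hP.1.eigenvectorUnitary : Matrix n n ℂ),
    star (hP.1.eigenvectorUnitary : Matrix n n ℂ), ?_, fun ε hε => ?_⟩
  · conv_rhs => rw [hP.1.spectral_theorem, Unitary.conjStarAlgAut_apply]
    rw [Matrix.conjTranspose_mul, Matrix.diagonal_conjTranspose, hdstar,
      ← Matrix.star_eq_conjTranspose, star_star, Matrix.mul_assoc,
      ← Matrix.mul_assoc (Matrix.diagonal _), Matrix.diagonal_mul_diagonal, ← Matrix.mul_assoc, hdd]
  · have he : Matrix.diagonal (fun i => ((Real.sqrt (hP.1.eigenvalues i) : ℝ) : ℂ)) *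
          star (hP.1.eigenvectorUnitary : Matrix n n ℂ) +
          (ε : ℂ) • star (hP.1.eigenvectorUnitary : Matrix n n ℂ) =
        Matrix.diagonal (fun i => ((Real.sqrt (hP.1.eigenvalues i) + ε : ℝ) : ℂ)) *
          star (hP.1.eigenvectorUnitary : Matrix n n ℂ) := by
      ext i j
      simp [Matrix.diagonal_mul, add_mul]
    rw [he]
    refine (Matrix.isUnit_diagonal.2 (Pi.isUnit_iff.2 fun i => isUnit_iff_ne_zero.2 ?_)).mul ?_
    · exact Complex.ofReal_ne_zero.2 (add_pos_of_nonneg_of_pos (Real.sqrt_nonneg _) hε).ne'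
    · rw [← Unitary.coe_star]
      exact Unitary.isUnit_coe

variable {ι κ μ ι' κ' μ' : Type*} [Fintype ι] [Fintype κ] [Fintype μ] [Fintype ι'] [Fintype κ']
  [Fintype μ'] [DecidableEq ι] [DecidableEq κ] [DecidableEq μ] [DecidableEq ι'] [DecidableEq κ']
  [DecidableEq μ']

/-- **Singular actions are degenerations** (the case of CVZ Rem. 1.2 used here): if
`R_j + ε V_j` is invertible for every `ε > 0` then `s ⊵ (R₁ ⊗ R₂ ⊗ R₃)·s`, since
`(R_j + ε V_j)·s → (R_j)·s` as `ε → 0⁺` along the orbit of `s`.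
[cite: ChristandlVranaZuiddam2023, Rem. 1.2] -/
theorem tensorDegeneratesTo_actTensor_of_path (s : ι → κ → μ → ℂ) (R₁ V₁ : Matrix ι ι ℂ)
    (R₂ V₂ : Matrix κ κ ℂ) (R₃ V₃ : Matrix μ μ ℂ)
    (hU₁ : ∀ ε : ℝ, 0 < ε → IsUnit (R₁ + (ε : ℂ) • V₁))
    (hU₂ : ∀ ε : ℝ, 0 < ε → IsUnit (R₂ + (ε : ℂ) • V₂))
    (hU₃ : ∀ ε : ℝ, 0 < ε → IsUnit (R₃ + (ε : ℂ) • V₃)) :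
    TensorDegeneratesTo s (actTensor R₁ R₂ R₃ s) := by
  have hfc : Continuous fun ε : ℝ =>
      actTensor (R₁ + (ε : ℂ) • V₁) (R₂ + (ε : ℂ) • V₂) (R₃ + (ε : ℂ) • V₃) s := by
    refine continuous_pi fun a => continuous_pi fun b => continuous_pi fun c => ?_
    simp only [actTensor_apply, Matrix.add_apply, Matrix.smul_apply, smul_eq_mul]
    fun_prop
  have hf0 : actTensor (R₁ + ((0 : ℝ) : ℂ) • V₁) (R₂ + ((0 : ℝ) : ℂ) • V₂)
      (R₃ + ((0 : ℝ) : ℂ) • V₃) s = actTensor R₁ R₂ R₃ s := by simp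
  have htend : Tendsto (fun ε : ℝ =>
      actTensor (R₁ + (ε : ℂ) • V₁) (R₂ + (ε : ℂ) • V₂) (R₃ + (ε : ℂ) • V₃) s)
      (𝓝[>] 0) (𝓝 (actTensor R₁ R₂ R₃ s)) := by
    rw [← hf0]
    exact tendsto_nhdsWithin_of_tendsto_nhds hfc.continuousAt.tendsto
  unfold TensorDegeneratesTo
  refine mem_closure_of_tendsto htend (eventually_nhdsWithin_of_forall fun ε (hε : 0 < ε) => ?_)
  exact ⟨((hU₁ ε hε).unit, (hU₂ ε hε).unit, (hU₃ ε hε).unit), by simp only [IsUnit.unit_spec]⟩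

/-- **CVZ Lemma 3.20 with Rem. 3.17, format-free**: for rectangular `M_j` of arbitrary target
formats with `(M₁ ⊗ M₂ ⊗ M₃)·s ≠ 0`, `H_θ((M₁ ⊗ M₂ ⊗ M₃)·s) ≤ E_θ(s)` (write `M_jᴴM_j = R_jᴴR_j`
with `R_j` square as in `exists_gram_sqrt_path`; then `(M₁ ⊗ M₂ ⊗ M₃)·s` and `(R₁ ⊗ R₂ ⊗ R₃)·s`
have the same `H_θ` and norm, and the latter is a nonzero degeneration of `s`).
[cite: ChristandlVranaZuiddam2023, Lemma 3.20] -/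
theorem quantumEntropy_actTensor_le_logQuantumFunctional_of_ne_zero {θ : Fin 3 → ℝ}
    (hθ : ∀ i, 0 ≤ θ i) (s : ι → κ → μ → ℂ) (M₁ : Matrix ι' ι ℂ) (M₂ : Matrix κ' κ ℂ)
    (M₃ : Matrix μ' μ ℂ) (hne : actTensor M₁ M₂ M₃ s ≠ 0) :
    quantumEntropy θ (actTensor M₁ M₂ M₃ s) ≤ logQuantumFunctional θ s := by
  obtain ⟨R₁, V₁, hR₁, hU₁⟩ :=
    exists_gram_sqrt_path (Matrix.posSemidef_conjTranspose_mul_self M₁)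
  obtain ⟨R₂, V₂, hR₂, hU₂⟩ :=
    exists_gram_sqrt_path (Matrix.posSemidef_conjTranspose_mul_self M₂)
  obtain ⟨R₃, V₃, hR₃, hU₃⟩ :=
    exists_gram_sqrt_path (Matrix.posSemidef_conjTranspose_mul_self M₃)
  rw [quantumEntropy_actTensor_eq_of_gram_eq θ s hR₁.symm hR₂.symm hR₃.symm]
  have hne' : actTensor R₁ R₂ R₃ s ≠ 0 := by
    intro h0
    apply hne
    rw [← tensorNormSq_eq_zero_iff] at h0 ⊢
    rwa [tensorNormSq_actTensor_eq_of_gram_eq s hR₁.symm hR₂.symm hR₃.symm]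
  exact quantumEntropy_le_logQuantumFunctional_of_degeneratesTo hθ hne'
    (tensorDegeneratesTo_actTensor_of_path s R₁ V₁ R₂ V₂ R₃ V₃ hU₁ hU₂ hU₃)

/-- **`E_θ` is monotone under restriction** (CVZ Thm. 3.19.4 with Rem. 1.2 and Rem. 3.17):
`E_θ((A ⊗ B ⊗ C)·s) ≤ E_θ(s)` for all matrices `A, B, C` (any formats) whenever the restricted
tensor is nonzero: each `g·((A ⊗ B ⊗ C)·s) = (gA ⊗ gB ⊗ gC)·s` has `H_θ ≤ E_θ(s)`.
[cite: ChristandlVranaZuiddam2023, Thm. 3.19.4] -/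
theorem logQuantumFunctional_actTensor_le {θ : Fin 3 → ℝ} (hθ : ∀ i, 0 ≤ θ i)
    (s : ι → κ → μ → ℂ) (A : Matrix ι' ι ℂ) (B : Matrix κ' κ ℂ) (C : Matrix μ' μ ℂ)
    (hne : actTensor A B C s ≠ 0) :
    logQuantumFunctional θ (actTensor A B C s) ≤ logQuantumFunctional θ s := by
  refine ciSup_le fun g => ?_
  have hne' := actTensor_ne_zero_of_ne_zero hne g
  rw [actTensor_actTensor] at hne' ⊢
  exact quantumEntropy_actTensor_le_logQuantumFunctional_of_ne_zero hθ s _ _ _ hne'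

end Main

/-- **Discharge of the named fact `ChristandlVranaZuiddam2023_restriction_mono`** (CVZ Cor. 3.31:
the quantum functional is `≥`-monotone; Thm. 3.19.4 = Lemma 3.20 with Rem. 1.2 and Rem. 3.17):
for every `θ ∈ P([3])`, complex 3-tensor `s` and matrices `A, B, C` of any formats,
`F^θ((A ⊗ B ⊗ C)·s) ≤ F^θ(s)`. [cite: ChristandlVranaZuiddam2023, Cor. 3.31] -/
theorem ChristandlVranaZuiddam2023_restriction_mono_holds :
    ChristandlVranaZuiddam2023_restriction_mono.{u} := by
  intro θ hθ ι κ μ ι' κ' μ' _ _ _ _ _ _ _ _ _ _ _ _ s A B C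
  by_cases ht : actTensor A B C s = 0
  · rw [ht, quantumFunctional_zero]
    exact quantumFunctional_nonneg θ s
  · have hs : s ≠ 0 := by
      rintro rfl
      exact ht (actTensor_zero A B C)
    rw [quantumFunctional_of_ne_zero θ ht, quantumFunctional_of_ne_zero θ hs]
    exact Real.rpow_le_rpow_of_exponent_le one_le_two
      (logQuantumFunctional_actTensor_le hθ.1 s A B C ht)

end Literature.Computability.AlgebraicComplexity

end
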